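import Mathlib
import HarnessLib
import Summits.NavierStokesRegularity.NavierStokesRegularity.Theorems.PoloidalWindowDoorLrcModEntireVerticalCurtainUniqueness
import Summits.NavierStokesRegularity.NavierStokesRegularity.Theorems.PoloidalWindowDoorPoloidalWindowRigidityLayeredNoLoop

/-!
# Route `PoloidalWindowDoor`, item `LrcModEntire` (stmt-NavierStokesRegularity-20428), cell (Q4-curved), VERTICAL child —
# DETERMINACY OF THE WHOLE TIME `−1` SLICE BY THE VERTICAL-CURTAIN DATA, UP TO A CONSTANT HORIZONTAL DRIFT

Cell ns-regularity-ideate, stub-worker seat ns-poloidal-K2-p2 g19 under the LEAD of item 20428 (ns-poloidal-K2-p3 g18); `--supports stmt-NavierStokesRegularity-20428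
--as helper`.  Sequel of `…VerticalCurtainUniqueness` (the vertical component `U₂(−1,·)` is determined by `(Γ, R̃, μ(−1,·))`); kernel form of memo `Y-LADDER-K2p2g19.md`
§6(b), second arrow, slice part.

* ★ `slice_eq_add_const_of_verticalCurtainData` — two POLOIDAL profiles of the route's class with the same slab slope law `∂₂U_b = μ(t,x₂)∂_bU₂` (`|t+1| < ρ`,
  `|x₂| < ρ`, `μ(−1,·)` continuous and not identically zero on `(−ρ, ρ)`), horizontally critical in their vertical components on the same vertical cylinder `Γ × ℝ`
  (`Γ` a `C²` planar unit-speed curve) with the same values there, have time `−1` slices that DIFFER BY A CONSTANT HORIZONTAL VECTOR: `U¹(−1, y) = U²(−1, y) + c`,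
  `c₂ = 0`.  Proof: `U¹₂(−1,·) = U²₂(−1,·)` by `slice_two_eq_of_verticalCurtainData`; the difference `V := U¹(−1,·) − U²(−1,·)` is then a bounded `C²` field with
  `V₂ ≡ 0`, divergence-free and with `(curl V)₂ = 0`, so K2-p2's planar Liouville lemma `…LayeredNoLoop.planar_const_of_layered` makes `V₀, V₁` constant on every
  horizontal plane; the slab law gives `∂₂V_b = μ·∂_b V₂ = 0` on the slab, and real-analyticity of `z ↦ V(z e₂)` spreads `∂_z V ≡ 0` to all heights.
  (The remaining drift `c` is removed by the DYNAMICS — Galilean covariance + Type-I decay as `t → −∞` — which is paper, §6(b).)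

WHAT THIS IS NOT: not a claim about Navier–Stokes regularity; a rigidity lemma for the research residue of the (Q4) column (registry v18/v19 of item 20428); it closes nothing;
items 20428 / 19708 / 27893 OPEN (bears_on LADDER-NS N0).
-/

noncomputable section

set_option linter.dupNamespace false
set_option linter.style.longLine false

namespace Summit.NavierStokesRegularity.NavierStokesRegularity.Theorems.PoloidalWindowDoorLrcModEntireVerticalCurtainDeterminacy

open Set Function Filter Topology Metric
open scoped RealInnerProductSpace InnerProductSpace ContDiff
open Literature.Analysis Literature.Analysis.FluidPDE Literature.Analysis.UnboundedOperators
open Summit.NavierStokesRegularity.NavierStokesRegularity.Theorems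
open Summit.NavierStokesRegularity.NavierStokesRegularity.Theorems.PoloidalWindowDoorLrcModEntireVerticalCurtainUniqueness
open Summit.NavierStokesRegularity.NavierStokesRegularity.Theorems.PoloidalWindowDoorPoloidalWindowRigidityLayeredNoLoop
open Summit.NavierStokesRegularity.NavierStokesRegularity.Theorems.PoloidalWindowDoorLrcModEntireQ4CurvedTranslationPeriodic
open Summit.NavierStokesRegularity.NavierStokesRegularity.Theorems.PoloidalWindowDoorLrcModEntireSheetFlattenTools
open Summit.NavierStokesRegularity.NavierStokesRegularity.Theorems.LocalSineTubeDoorProfileAlignedWindowRigidityAncient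

/-- ★ **THE TIME `−1` SLICES OF TWO PROFILES WITH THE SAME VERTICAL-CURTAIN DATA DIFFER BY A CONSTANT HORIZONTAL VECTOR.**  See the module docstring. -/
theorem slice_eq_add_const_of_verticalCurtainData {C₁ C₂ : ℝ} {U₁ U₂ : ℝ → EuclideanSpace ℝ (Fin 3) → EuclideanSpace ℝ (Fin 3)}
    (hrate₁ : HasTypeITimeDecay C₁ U₁) (hcont₁ : ContinuousOn (uncurry U₁) (Iio (0 : ℝ) ×ˢ univ))
    (hmild₁ : ∀ s t : ℝ, s < t → t < 0 → ∀ x, U₁ t x = heatExtension (U₁ s) (t - s) x - oseenDuhamel 1 s U₁ U₁ t x)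
    (hdiv₁ : ∀ t < 0, VectorCalculus.IsDivFree (U₁ t))
    (hpol₁ : ∀ s < 0, ∀ q, ⟪curl (U₁ s) q, EuclideanSpace.single 2 1⟫_ℝ = 0)
    (hrate₂ : HasTypeITimeDecay C₂ U₂) (hcont₂ : ContinuousOn (uncurry U₂) (Iio (0 : ℝ) ×ˢ univ))
    (hmild₂ : ∀ s t : ℝ, s < t → t < 0 → ∀ x, U₂ t x = heatExtension (U₂ s) (t - s) x - oseenDuhamel 1 s U₂ U₂ t x)
    (hdiv₂ : ∀ t < 0, VectorCalculus.IsDivFree (U₂ t))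
    (hpol₂ : ∀ s < 0, ∀ q, ⟪curl (U₂ s) q, EuclideanSpace.single 2 1⟫_ℝ = 0)
    {μ : ℝ → ℝ → ℝ} {ρ : ℝ} (hρ : 0 < ρ) (hμc : Continuous (μ (-1))) (hμne : ∃ z₀ ∈ Ioo (-ρ) ρ, μ (-1) z₀ ≠ 0)
    (hslab₁ : ∀ t : ℝ, |t + 1| < ρ → ∀ x : EuclideanSpace ℝ (Fin 3), |x 2| < ρ → ∀ b : Fin 3, b ≠ 2 →
      fderiv ℝ (U₁ t) x (EuclideanSpace.single 2 1) b = μ t (x 2) * fderiv ℝ (U₁ t) x (EuclideanSpace.single b 1) 2)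
    (hslab₂ : ∀ t : ℝ, |t + 1| < ρ → ∀ x : EuclideanSpace ℝ (Fin 3), |x 2| < ρ → ∀ b : Fin 3, b ≠ 2 →
      fderiv ℝ (U₂ t) x (EuclideanSpace.single 2 1) b = μ t (x 2) * fderiv ℝ (U₂ t) x (EuclideanSpace.single b 1) 2)
    {Γ : ℝ → EuclideanSpace ℝ (Fin 3)} (hΓ : ContDiff ℝ 2 Γ) (hΓ2 : ∀ s, Γ s 2 = 0) (hunit : ∀ s, ‖deriv Γ s‖ = 1)
    (hcurt₁ : ∀ s z : ℝ, ∀ w : EuclideanSpace ℝ (Fin 3), w 2 = 0 → fderiv ℝ (fun y => U₁ (-1) y 2) (Γ s + z • EuclideanSpace.single 2 (1 : ℝ)) w = 0)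
    (hcurt₂ : ∀ s z : ℝ, ∀ w : EuclideanSpace ℝ (Fin 3), w 2 = 0 → fderiv ℝ (fun y => U₂ (-1) y 2) (Γ s + z • EuclideanSpace.single 2 (1 : ℝ)) w = 0)
    (hvals : ∀ s z : ℝ, U₁ (-1) (Γ s + z • EuclideanSpace.single 2 (1 : ℝ)) 2 = U₂ (-1) (Γ s + z • EuclideanSpace.single 2 (1 : ℝ)) 2) :
    ∃ c : EuclideanSpace ℝ (Fin 3), c 2 = 0 ∧ ∀ y, U₁ (-1) y = U₂ (-1) y + c := by
  have hs1 : (-1 : ℝ) < 0 := by norm_num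
  have he2 : (EuclideanSpace.single 2 (1 : ℝ) : EuclideanSpace ℝ (Fin 3)) = e2 := rfl
  -- (0) the vertical components agree
  have hθ := slice_two_eq_of_verticalCurtainData hrate₁ hcont₁ hmild₁ hdiv₁ hrate₂ hcont₂ hmild₂ hdiv₂ hρ hμc hμne hslab₁ hslab₂ hΓ hΓ2 hunit
    hcurt₁ hcurt₂ hvals
  -- analyticity / smoothness of the two slices and of the difference
  have han₁ : AnalyticOnNhd ℝ (U₁ (-1)) univ := analyticOnNhd_slice hcont₁ (bdd_of_hasTypeITimeDecay hrate₁) hmild₁ hs1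
  have han₂ : AnalyticOnNhd ℝ (U₂ (-1)) univ := analyticOnNhd_slice hcont₂ (bdd_of_hasTypeITimeDecay hrate₂) hmild₂ hs1
  set V : EuclideanSpace ℝ (Fin 3) → EuclideanSpace ℝ (Fin 3) := fun y => U₁ (-1) y - U₂ (-1) y with hV_def
  have hVan : AnalyticOnNhd ℝ V univ := fun y hy => (han₁ y hy).sub (han₂ y hy)
  have hVC : ContDiff ℝ 2 V := hVan.contDiff
  have hd₁ : Differentiable ℝ (U₁ (-1)) := fun y => (han₁ y (mem_univ _)).differentiableAt
  have hd₂ : Differentiable ℝ (U₂ (-1)) := fun y => (han₂ y (mem_univ _)).differentiableAt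
  have hVd : Differentiable ℝ V := fun y => (hVan y (mem_univ _)).differentiableAt
  have hfdV : ∀ y h : EuclideanSpace ℝ (Fin 3), fderiv ℝ V y h = fderiv ℝ (U₁ (-1)) y h - fderiv ℝ (U₂ (-1)) y h := by
    intro y h
    rw [hV_def, fderiv_fun_sub (hd₁ y) (hd₂ y)]
    rfl
  -- (1) `V₂ ≡ 0`, hence its horizontal derivatives vanish
  have hV2 : ∀ y, V y 2 = 0 := by
    intro y
    have h := congrFun hθ y
    simp only at h
    show (U₁ (-1) y - U₂ (-1) y) 2 = 0
    rw [PiLp.sub_apply, h, sub_self]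
  have hw : ∀ y h : EuclideanSpace ℝ (Fin 3), fderiv ℝ V y h 2 = 0 := by
    intro y h
    rw [← fderiv_apply_coord_vec3 (hVd y) 2]
    have hz : (fun y => V y 2) = fun _ => (0 : ℝ) := funext hV2
    rw [hz]; simp
  -- (2) `V` is divergence-free and `(curl V)₂ = 0`
  have hdivV : VectorCalculus.IsDivFree V := by
    intro x
    have h1 := hdiv₁ (-1) hs1 x
    have h2 := hdiv₂ (-1) hs1 x
    simp only [VectorCalculus.divergence] at h1 h2 ⊢
    rw [hV_def, fderiv_fun_sub (hd₁ x) (hd₂ x)]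
    simp [map_sub, h1, h2]
  have hsym_of : ∀ {U : EuclideanSpace ℝ (Fin 3) → EuclideanSpace ℝ (Fin 3)}, (∀ q, ⟪curl U q, EuclideanSpace.single 2 1⟫_ℝ = 0) →
      ∀ y, fderiv ℝ U y (EuclideanSpace.single 0 1) 1 = fderiv ℝ U y (EuclideanSpace.single 1 1) 0 := by
    intro U hpol y
    have h : curl U y 2 = 0 := by simpa [EuclideanSpace.inner_single_right] using hpol y
    simp only [curl, Fin.isValue, Matrix.cons_val_two, Matrix.tail_cons, Matrix.head_cons, sub_eq_zero] at h
    simpa [curl, sub_eq_zero] using h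
  have hsym₁ := hsym_of (hpol₁ (-1) hs1)
  have hsym₂ := hsym_of (hpol₂ (-1) hs1)
  have hsymV : ∀ y, fderiv ℝ V y (EuclideanSpace.single 0 1) 1 = fderiv ℝ V y (EuclideanSpace.single 1 1) 0 := by
    intro y
    rw [hfdV, hfdV, PiLp.sub_apply, PiLp.sub_apply, hsym₁ y, hsym₂ y]
  -- (3) boundedness
  obtain ⟨B₁, hB₁⟩ := bdd_of_hasTypeITimeDecay hrate₁ (1 / 2) (by norm_num)
  obtain ⟨B₂, hB₂⟩ := bdd_of_hasTypeITimeDecay hrate₂ (1 / 2) (by norm_num)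
  have hB : ∀ y, ‖V y‖ ≤ B₁ + B₂ := fun y =>
    (norm_sub_le _ _).trans (add_le_add (hB₁ (-1) (by norm_num) y) (hB₂ (-1) (by norm_num) y))
  -- (4) planar Liouville: `V₀, V₁` are constant on horizontal planes
  have hplanar : ∀ i : Fin 3, i ≠ 2 → ∀ y y' : EuclideanSpace ℝ (Fin 3), y 2 = y' 2 → V y i = V y' i := fun i hi y y' hyy' =>
    planar_const_of_layered hVC hsymV hdivV (fun y => hw y _) (fun y => hw y _) hB i hi y y' hyy'
  -- (5) the vertical profile `z ↦ V (z•e₂) b` has zero derivative on the slab, hence everywhere (analyticity)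
  have hμθ : ∀ x : EuclideanSpace ℝ (Fin 3), ∀ b : Fin 3, fderiv ℝ (U₁ (-1)) x (EuclideanSpace.single b 1) 2 = fderiv ℝ (U₂ (-1)) x (EuclideanSpace.single b 1) 2 := by
    intro x b
    rw [← fderiv_apply_coord_vec3 (hd₁ x) 2, ← fderiv_apply_coord_vec3 (hd₂ x) 2, hθ]
  have hconst : ∀ b : Fin 3, b ≠ 2 → ∀ z : ℝ, V (z • e2) b = V 0 b := by
    intro b hb
    set g : ℝ → ℝ := fun z => V ((0 : EuclideanSpace ℝ (Fin 3)) + z • e2) b with hg_def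
    have hgan : AnalyticOnNhd ℝ g univ := by
      intro z _
      have hl : AnalyticAt ℝ (fun z : ℝ => (0 : EuclideanSpace ℝ (Fin 3)) + z • e2) z :=
        analyticAt_const.add ((analyticAt_id).smul analyticAt_const)
      exact ((ContinuousLinearMap.proj (R := ℝ) (φ := fun _ : Fin 3 => ℝ) b).analyticAt _).comp
        ((PiLp.continuousLinearEquiv 2 ℝ (fun _ : Fin 3 => ℝ)).analyticAt _) |>.comp ((hVan _ (mem_univ _)).comp hl)
    have hVb : Differentiable ℝ (fun y => V y b) := (contDiff_apply_coord_vec3 hVC b).differentiable two_ne_zero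
    have hderiv : ∀ z : ℝ, deriv g z = fderiv ℝ V ((0 : EuclideanSpace ℝ (Fin 3)) + z • e2) e2 b := by
      intro z
      rw [hg_def, ← fderiv_line_e2 hVb 0 z, fderiv_apply_coord_vec3 (hVd _) b]
    have hzero_slab : ∀ z ∈ Ioo (-ρ) ρ, deriv g z = 0 := by
      intro z hz
      rw [hderiv, hfdV, PiLp.sub_apply]
      have hx2 : ((0 : EuclideanSpace ℝ (Fin 3)) + z • e2) 2 = z := by simp [e2]
      have hxρ : |((0 : EuclideanSpace ℝ (Fin 3)) + z • e2) 2| < ρ := by rw [hx2]; exact abs_lt.2 ⟨hz.1, hz.2⟩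
      have h1 : fderiv ℝ (U₁ (-1)) ((0 : EuclideanSpace ℝ (Fin 3)) + z • e2) e2 b =
          μ (-1) z * fderiv ℝ (U₁ (-1)) ((0 : EuclideanSpace ℝ (Fin 3)) + z • e2) (EuclideanSpace.single b 1) 2 := by
        have h := hslab₁ (-1) (by simpa using hρ) _ hxρ b hb
        rw [hx2] at h
        exact h
      have h2 : fderiv ℝ (U₂ (-1)) ((0 : EuclideanSpace ℝ (Fin 3)) + z • e2) e2 b =
          μ (-1) z * fderiv ℝ (U₂ (-1)) ((0 : EuclideanSpace ℝ (Fin 3)) + z • e2) (EuclideanSpace.single b 1) 2 := by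
        have h := hslab₂ (-1) (by simpa using hρ) _ hxρ b hb
        rw [hx2] at h
        exact h
      rw [h1, h2, hμθ, sub_self]
    -- spread by analyticity of `deriv g`
    have hgdan : AnalyticOnNhd ℝ (deriv g) univ := hgan.deriv
    have hev : deriv g =ᶠ[𝓝 0] 0 := by
      filter_upwards [isOpen_Ioo.mem_nhds (show (0 : ℝ) ∈ Ioo (-ρ) ρ from ⟨by linarith, hρ⟩)] with z hz
      exact hzero_slab z hz
    have hzero : ∀ z, deriv g z = 0 := fun z =>
      hgdan.eqOn_zero_of_preconnected_of_eventuallyEq_zero isPreconnected_univ (mem_univ 0) hev (mem_univ z)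
    have hgd : Differentiable ℝ g := fun z => (hgan z (mem_univ _)).differentiableAt
    intro z
    have h := is_const_of_deriv_eq_zero hgd hzero z 0
    simpa [hg_def] using h
  -- (6) conclusion: `V ≡ V 0`
  refine ⟨V 0, hV2 0, fun y => ?_⟩
  have hVy : V y = V 0 := by
    ext i
    by_cases hi : i = 2
    · subst hi; rw [hV2, hV2]
    · have h1 : V y i = V ((y 2) • e2) i := hplanar i hi y _ (by simp [e2])
      rw [h1, hconst i hi]
  show U₁ (-1) y = U₂ (-1) y + V 0
  rw [← hVy]
  simp only [hV_def]
  abel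

end Summit.NavierStokesRegularity.NavierStokesRegularity.Theorems.PoloidalWindowDoorLrcModEntireVerticalCurtainDeterminacy

end
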